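import Summits.PneNP.PneNP.Theses.RootDecompSpaceCeiling
import Literature.Computability.Complexity.Counting
import Literature.Computability.Complexity.CountingProofs
import Literature.Computability.Complexity.PolyHierarchy
import Literature.Computability.Complexity.Oracle
import Literature.Computability.Complexity.OracleEmpty
import Literature.Computability.Complexity.OracleProofs
import Literature.Computability.Complexity.SpaceTMSAT
import Literature.Computability.Complexity.SpaceOracles
import Literature.Computability.Complexity.SpaceOraclesProofs
import Literature.Computability.Complexity.CountingHierarchyPSPACE
import Literature.Barriers.PneNP.Relativization

/-! # Root decomposition N3 (SpaceCeiling) — LAW (xiii): the REL column of the blocker certificate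

Closes the aside item stmt-PneNP-32376 `KRelCertificate` of route
`route-PneNP-RootDecompSpaceCeiling` (cycle-2 node (b) of the decomp-pnenp cell; writer g6 rev 7;
critic ruling D24). With the relativized residual `K^O := NP^O ⊆ P^O → PP^O ⊆ P^O` over the tree's
`PRel / NPRel / PPRel` and the catalogued barrier's own `Literature.Barriers.PneNP.Relativizes`:
(1) anchor `K^∅ ⟺ CollapseLift`; (2) `K` HOLDS relative to the PSPACE-complete `SPACETMSAT`;
(3) hence `¬K` never relativizes; (4) `K` fails to relativize EXACTLY iff a `PP`-separating collapse
world exists (the Aaronson–Ingram–Kretschmer binder, necessary and sufficient).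

Port of lens-5 g11 §0 / lens-6 g12–g13 Part VI / writer certificate `N3C2_items-g6.lean`
(`kRelCertificate_holds`). Hypothesis-free; standard axioms only.
-/

namespace Summit.PneNP.PneNP.Theorems

open Literature.Computability.Complexity

/-- LAW (xiii) REL column on `K = CollapseLift` (stmt-PneNP-23703): anchor at `O = ∅`, truth at the
PSPACE world (`PP^A ⊆ PSPACE = P^A` for `A = SPACETMSAT`), `¬K` never relativizes, and
`¬Relativizes K ↔ ∃` a PP-separating collapse world. Closes stmt-PneNP-32376. -/
theorem kRelCertificate_proof :
    Summit.PneNP.PneNP.Theses.RootDecompSpaceCeiling.KRelCertificate := by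
  unfold Summit.PneNP.PneNP.Theses.RootDecompSpaceCeiling.KRelCertificate
    Summit.PneNP.PneNP.Theses.RootDecompSpaceCeiling.CollapseLift
  -- `K` holds in the PSPACE world
  have hW : NPRel (Oracle.ofLanguage SPACETMSAT) ⊆ PRel (Oracle.ofLanguage SPACETMSAT) →
      PPRel (Oracle.ofLanguage SPACETMSAT) ⊆ PRel (Oracle.ofLanguage SPACETMSAT) := by
    intro _
    rw [PPRel_eq, PRel_SPACETMSAT_eq_PSPACE.1]
    exact pMajority_PSPACE_subset_PSPACE
  -- `PP` relative to the empty oracle is `PP`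
  have hE : PPRel Oracle.empty = PP := by
    rw [PPRel_eq, show PRel Oracle.empty = Classes.P from PRel_empty_holds]
    rfl
  refine ⟨?_, hW, fun h => h SPACETMSAT hW, ?_⟩
  · rw [NPRel_empty, hE, show PRel Oracle.empty = Classes.P from PRel_empty_holds]
  · constructor
    · intro h
      by_contra hX
      apply h
      intro B hB
      by_contra hY
      exact hX ⟨B, hB, hY⟩
    · rintro ⟨B, hB, hB'⟩ hrel
      exact hB' (hrel B hB)

end Summit.PneNP.PneNP.Theorems
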